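/-
Copyright (c) 2026 the pub-hodgecm-mathlib formalisation cell (harness21).  Prover seat hodgecm-mathlib-F0P2-p11 (g4), routed by chair K2-lead (g2) ACROSS-LINES VALVE 22 (z) to R90-TF
section S8 «ContSpec-n½» (dealer R90-CS-plan (g3), S8-R233 (1) 2026-09-05T02:41Z): `K2E1ChiFiniteWitnessIntegrableU3` — R90-CS-p03 (g3)'s unfolding-estate letter `hfin`
(census `R90/S8/CENSUS-UnfoldingAtBasePoint.R90-CS-p03-g3.md` item 4), consumer ★ p864589 `K2E1ChiMidBlockUnfoldingAtBasePointU3.exists_pos_middleCoefficient_basePoint_eq_chiEulerProduct`.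
-/
import Summits.HodgeConjecture.HodgeConjecture.Theorems.K2E1IntertwiningFiniteIntegrabilityU3   -- ★ (K2E2-p12 (g5), brick (3-iv-d)): `continuous_coe_heightFactor`, §4 `integrable_prod_heightFactor_rpow_of_integrable`
import HarnessLib

/-!
# K2·E1 ∕ R90·S8 — `K2E1ChiFiniteWitnessIntegrableU3`: THE FINITE BIG-CELL INTEGRAND `Ω·h_f^{−z}` OF A BOUNDED WITNESS WEIGHT IS INTEGRABLE ON `𝔸_{L,f} × 𝔸_{L⁺,f}` (the letter `hfin`)

Cell `pub/hodgecm-mathlib`, crux h413 = `stmt-HodgeConjecture-24833`, route of record `HCCMUnconditional`; R90-TF section S8 «ContSpec-n½», road R2-χ₃, the unfolding row at the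
moved base point `g₁ = ι_f(w₀^{S₀})` (R90-CS-p03 (g3)).  THEOREMS ONLY (no `def`, no `instance`, no notation, no named-fact hypothesis, no `sorry`; default heartbeats); lane
`--supports stmt-HodgeConjecture-24833 --as helper` (count-neutral).  Closes no socket.

THE MATHEMATICS ([MoeglinWaldspurger1995] II.1.6–II.1.7; [CasselsFrohlichANT1967] Ch. XV §3.3).  ★ p864589 unfolds the middle coefficient `ψ_z(g₁)` through ★ (a-2b) GIVEN, among
(a-2b)'s letters, the finite integrability `hfin : (X_f, b) ↦ Ω(X_f, b)·h_f((0,X_f), b)^{−z} ∈ L¹(μ_{E,f} ⊗ μ_{F,f})` (`2 < Re z`), where `h_f = ∏ᶠ_w max(1, ‖X_w‖, ‖Z_w‖)` is the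
finite height factor of the Heisenberg big cell and `Ω` the finite weight of the witness (a pure tensor `∏ᶠ_v ω_v` with `ω_v = 𝟙_{B_v(𝔫)}` on `S₀`, spherical off `S₀`; `‖Ω‖ ≤ 1`).
Since `h_f ≥ 1`, `‖(h_f : ℂ)^{−z}‖ = h_f^{−Re z}`; so for ANY a.e.-strongly-measurable weight `Ω` with `‖Ω‖ ≤ M` the letter follows from the SPHERICAL finite integrability
`(X_f, b) ↦ h_f^{−σ} ∈ L¹` at `σ := Re z` — which is ★ `K2E1IntertwiningFiniteIntegrabilityU3.integrable_prod_heightFactor_rpow_of_integrable` (K2E2-p12) under the Godement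
letter `hT` (`v ↦ H(ι(w₀)·v)^σ ∈ L¹(N(𝔸))`), `hc1`, `hIw`.  Everything is hypothesis-first: `Ω` is ANY weight with the two letters `hΩm` (measurability) and `hΩM` (bound).
* §1 (generic, any measure space) **`integrable_mul_ofReal_cpow_of_rpow`** — `F ≥ 1` a.e.-strongly measurable, `Ω` a.e.-strongly measurable with `‖Ω‖ ≤ M`,
  `x ↦ ((F x)^{−Re z} : ℂ) ∈ L¹` ⟹ `x ↦ Ω x·(F x : ℂ)^{−z} ∈ L¹` (`Complex.norm_cpow_eq_rpow_re_of_pos`, `Integrable.mono'`, `Integrable.bdd_mul`); `aestronglyMeasurable_ofReal_cpow_of_one_le`.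
* §2 `continuous_coe_heightFactor_fin` — `(X_f, b) ↦ h_f((0, X_f), b)` is continuous on `𝔸_{L,f} × 𝔸_{L⁺,f}` (★ `continuous_coe_heightFactor` ∘ the embedding).
* §3 HEAD **`integrable_finiteWitness_of_spherical`** — `hΩm`, `hΩM`, the spherical letter `hsph` (★ K2E2-p12 §4's conclusion at `σ := Re z`) ⟹ ★ p864589's `hfin` binder BYTES.
* §4 HEAD′ **`integrable_finiteWitness_of_height_integrable`** — the same bytes from (`hc1`, `hIw`, `hT` at `σ := Re z`) ∘ ★ K2E2-p12 §4; and `aestronglyMeasurable_weight_of_continuous`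
  (a continuous weight — e.g. the locally constant `θ(b)·𝟙_{B_f·K_f(𝔫)}` — pays `hΩm`).
HONEST LABEL: HC_CM is proved only modulo the 7 printed citations (2 remaining named inputs: hLiu418 = `stmt-HodgeConjecture-24832`, h413 = `stmt-HodgeConjecture-24833`) until rung 0
closes; REL ≠ ★ ≠ BUILT; this file asserts no named fact and closes no socket; conditional only on its displayed letters (`hΩm`, `hΩM`, `hsph` ∕ `hT`, `hc`, `hc1`, `hIw`); count-neutral.

## References
* [MoeglinWaldspurger1995] C. Mœglin, J.-L. Waldspurger, *Spectral Decomposition and Eisenstein Series* (1995): II.1.6–II.1.7.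
* [CasselsFrohlichANT1967] J. W. S. Cassels, A. Fröhlich (eds.), *Algebraic Number Theory* (1967): Ch. XV §3.3.
* [Rogawski1990] J. D. Rogawski, *Automorphic Representations of Unitary Groups in Three Variables* (1990): §7.3, §13.9 p. 229.
-/

set_option autoImplicit false
set_option linter.dupNamespace false -- the mandated namespace repeats `HodgeConjecture.HodgeConjecture`

noncomputable section

open MeasureTheory MeasureTheory.Measure NumberField NumberField.InfinitePlace IsDedekindDomain Filter
open scoped NNReal ENNReal
open Literature.NumberTheory.Automorphic Literature.NumberTheory.Automorphic.UnitaryGroup Literature.NumberTheory.GaloisRepresentations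
open Literature.NumberTheory.GaloisRepresentations.IsNonarchimedeanLocalField
open Summit.HodgeConjecture.HodgeConjecture.Cruxes.H413
open Summit.HodgeConjecture.HodgeConjecture.Cruxes.H413.K2E1HeightBigCellLineFormulaU3 (one_le_coe_finprod_heisZ_line_cm_three)
open Summit.HodgeConjecture.HodgeConjecture.Cruxes.H413.K2E1IntertwiningFiniteIntegrabilityU3 (continuous_coe_heightFactor integrable_prod_heightFactor_rpow_of_integrable)

namespace Summit.HodgeConjecture.HodgeConjecture.Cruxes.H413.K2E1ChiFiniteWitnessIntegrableU3

/-! ## §1 Generic: a bounded measurable weight times `(F : ℂ)^{−z}`, `F ≥ 1`, is integrable once `F^{−Re z}` is -/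

section Generic

variable {α : Type*} [MeasurableSpace α] {μ : Measure α}

/-- **`x ↦ (F x : ℂ)^{−z}` IS A.E.-STRONGLY MEASURABLE** for an a.e.-strongly measurable real `F ≥ 1`: it is `t ↦ ((max 1 t : ℝ) : ℂ)^{−z}` (continuous on all of `ℝ`,
`Complex.continuousAt_ofReal_cpow_const` off `0`) composed with `F`. [folklore] -/
theorem aestronglyMeasurable_ofReal_cpow_of_one_le {F : α → ℝ} (hF : AEStronglyMeasurable F μ) (hF1 : ∀ x, 1 ≤ F x) (z : ℂ) :
    AEStronglyMeasurable (fun x => ((F x : ℝ) : ℂ) ^ (-z)) μ := by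
  have hcont : Continuous fun t : ℝ => ((max 1 t : ℝ) : ℂ) ^ (-z) :=
    continuous_iff_continuousAt.2 fun t =>
      (Complex.continuousAt_ofReal_cpow_const (max 1 t) (-z) (Or.inr (lt_of_lt_of_le one_pos (le_max_left 1 t)).ne')).comp
        (continuous_const.max continuous_id).continuousAt
  refine (hcont.comp_aestronglyMeasurable hF).congr (Eventually.of_forall fun x => ?_)
  simp only [max_eq_right (hF1 x)]

/-- **A BOUNDED MEASURABLE WEIGHT TIMES `(F : ℂ)^{−z}` IS INTEGRABLE ONCE `F^{−Re z}` IS** (`F ≥ 1`): `‖(F x : ℂ)^{−z}‖ = (F x)^{−Re z}` (`Complex.norm_cpow_eq_rpow_re_of_pos`), so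
`x ↦ (F x : ℂ)^{−z} ∈ L¹` (`Integrable.mono'`), and `Ω·` keeps it there (`Integrable.bdd_mul`). [cite: MoeglinWaldspurger1995, II.1.6] -/
theorem integrable_mul_ofReal_cpow_of_rpow {F : α → ℝ} (hF : AEStronglyMeasurable F μ) (hF1 : ∀ x, 1 ≤ F x)
    (Ω : α → ℂ) (hΩm : AEStronglyMeasurable Ω μ) {M : ℝ} (hΩM : ∀ x, ‖Ω x‖ ≤ M) {z : ℂ}
    (hsph : Integrable (fun x => ((((F x) ^ (-z.re) : ℝ)) : ℂ)) μ) :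
    Integrable (fun x => Ω x * (((F x : ℝ) : ℂ) ^ (-z))) μ := by
  have hpow : Integrable (fun x => ((F x : ℝ) : ℂ) ^ (-z)) μ := by
    refine hsph.norm.mono' (aestronglyMeasurable_ofReal_cpow_of_one_le hF hF1 z) (Eventually.of_forall fun x => le_of_eq ?_)
    have hpos : 0 < F x := lt_of_lt_of_le one_pos (hF1 x)
    rw [Complex.norm_cpow_eq_rpow_re_of_pos hpos, Complex.neg_re, Complex.norm_of_nonneg (Real.rpow_nonneg hpos.le _)]
  exact hpow.bdd_mul hΩm (Eventually.of_forall hΩM)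

end Generic

/-! ## §2 The finite height factor on `𝔸_{L,f} × 𝔸_{L⁺,f}` is continuous -/

variable (L : Type) [Field L] [NumberField L] [IsCMField L] (hc : IsCMField.complexConj L * IsCMField.complexConj L = 1)
  {δ : L} (hcδ : IsCMField.complexConj L δ = -δ) (hδ : δ ≠ 0)

include hc in
/-- **`(X_f, b) ↦ h_f((0, X_f), b)` IS CONTINUOUS on `𝔸_{L,f} × 𝔸_{L⁺,f}`** (★ `continuous_coe_heightFactor` on `𝔸_L × 𝔸_{L⁺,f}` ∘ `X_f ↦ (0, X_f)`). [cite: Rogawski1990, §7.3] -/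
theorem continuous_coe_heightFactor_fin :
    Continuous fun q : FiniteAdeleRing (𝓞 L) L × FiniteAdeleRing (𝓞 ↥(maximalRealSubfield L)) ↥(maximalRealSubfield L) =>
      (((∏ᶠ w : HeightOneSpectrum (𝓞 L), max 1 (max ‖((((0 : InfiniteAdeleRing L)), q.1) : AdeleRing (𝓞 L) L).2 w‖₊
              ‖(heisZ (c := IsCMField.complexConj L) ((((0 : InfiniteAdeleRing L)), q.1) : AdeleRing (𝓞 L) L)
                ((traceZeroLine ↥(maximalRealSubfield L) L (IsCMField.complexConj L) hcδ hδ ((0, q.2) : AdeleRing (𝓞 ↥(maximalRealSubfield L)) ↥(maximalRealSubfield L)) : traceZeroAdele ↥(maximalRealSubfield L) L (IsCMField.complexConj L)) : AdeleRing (𝓞 L) L)).2 w‖₊) : ℝ≥0)) : ℝ) := by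
  have hι : Continuous fun q : FiniteAdeleRing (𝓞 L) L × FiniteAdeleRing (𝓞 ↥(maximalRealSubfield L)) ↥(maximalRealSubfield L) =>
      ((((0 : InfiniteAdeleRing L), q.1) : AdeleRing (𝓞 L) L), q.2) :=
    (continuous_const.prodMk continuous_fst).prodMk continuous_snd
  have h := (continuous_coe_heightFactor L hc hcδ hδ).comp hι
  simpa only [Function.comp_def] using h

/-! ## §3 HEAD: the letter `hfin` of ★ p864589 from a bounded measurable weight and the spherical finite integrability -/

include hc in
/-- **HEAD — THE FINITE BIG-CELL INTEGRAND OF A BOUNDED WITNESS WEIGHT IS INTEGRABLE (the letter `hfin` of ★ p864589 ∕ ★ (a-2b), BYTES VERBATIM).**  For ANY finite weight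
`Ω : 𝔸_{L,f} → 𝔸_{L⁺,f} → ℂ` that is a.e.-strongly measurable on the product (`hΩm`) and bounded (`hΩM : ‖Ω X b‖ ≤ M`; `M = 1` at the witness `θ(b)·𝟙_{B_f·K_f(𝔫)}`), and any `z`
at which the SPHERICAL finite integrand `h_f((0,X_f), b)^{−Re z}` is `μ_{E,f} ⊗ μ_{F,f}`-integrable (`hsph` — ★ K2E2-p12 §4 `integrable_prod_heightFactor_rpow_of_integrable` at
`σ := Re z`), the integrand `Ω(X_f, b)·h_f((0,X_f), b)^{−z}` is `μ_{E,f} ⊗ μ_{F,f}`-integrable. [cite: MoeglinWaldspurger1995, II.1.6–II.1.7] [cite: CasselsFrohlichANT1967, Ch. XV §3.3] -/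
theorem integrable_finiteWitness_of_spherical
    [MeasurableSpace (FiniteAdeleRing (𝓞 L) L)] [BorelSpace (FiniteAdeleRing (𝓞 L) L)]
    [MeasurableSpace (FiniteAdeleRing (𝓞 ↥(maximalRealSubfield L)) ↥(maximalRealSubfield L))] [BorelSpace (FiniteAdeleRing (𝓞 ↥(maximalRealSubfield L)) ↥(maximalRealSubfield L))]
    (μE₂ : Measure (FiniteAdeleRing (𝓞 L) L)) (μF₂ : Measure (FiniteAdeleRing (𝓞 ↥(maximalRealSubfield L)) ↥(maximalRealSubfield L)))
    (Ω : FiniteAdeleRing (𝓞 L) L → FiniteAdeleRing (𝓞 ↥(maximalRealSubfield L)) ↥(maximalRealSubfield L) → ℂ)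
    (hΩm : AEStronglyMeasurable (fun q : FiniteAdeleRing (𝓞 L) L × FiniteAdeleRing (𝓞 ↥(maximalRealSubfield L)) ↥(maximalRealSubfield L) => Ω q.1 q.2) (μE₂.prod μF₂))
    {M : ℝ} (hΩM : ∀ X b, ‖Ω X b‖ ≤ M) {z : ℂ}
    (hsph : Integrable (fun q : FiniteAdeleRing (𝓞 L) L × FiniteAdeleRing (𝓞 ↥(maximalRealSubfield L)) ↥(maximalRealSubfield L) =>
      ((((∏ᶠ w : HeightOneSpectrum (𝓞 L), max 1 (max ‖((((0 : InfiniteAdeleRing L)), q.1) : AdeleRing (𝓞 L) L).2 w‖₊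
              ‖(heisZ (c := IsCMField.complexConj L) ((((0 : InfiniteAdeleRing L)), q.1) : AdeleRing (𝓞 L) L)
                ((traceZeroLine ↥(maximalRealSubfield L) L (IsCMField.complexConj L) hcδ hδ ((0, q.2) : AdeleRing (𝓞 ↥(maximalRealSubfield L)) ↥(maximalRealSubfield L)) : traceZeroAdele ↥(maximalRealSubfield L) L (IsCMField.complexConj L)) : AdeleRing (𝓞 L) L)).2 w‖₊) : ℝ≥0) : ℝ) ^ (-z.re) : ℝ) : ℂ)) (μE₂.prod μF₂)) :
    Integrable (fun q : FiniteAdeleRing (𝓞 L) L × FiniteAdeleRing (𝓞 ↥(maximalRealSubfield L)) ↥(maximalRealSubfield L) =>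
        (Ω (q.1) (q.2) * ((((∏ᶠ w : HeightOneSpectrum (𝓞 L), max 1 (max ‖((((0 : InfiniteAdeleRing L)), q.1) : AdeleRing (𝓞 L) L).2 w‖₊ ‖(heisZ (c := IsCMField.complexConj L) ((((0 : InfiniteAdeleRing L)), q.1) : AdeleRing (𝓞 L) L) ((traceZeroLine ↥(maximalRealSubfield L) L (IsCMField.complexConj L) hcδ hδ ((0, q.2) : AdeleRing (𝓞 ↥(maximalRealSubfield L)) ↥(maximalRealSubfield L)) : traceZeroAdele ↥(maximalRealSubfield L) L (IsCMField.complexConj L)) : AdeleRing (𝓞 L) L)).2 w‖₊) : ℝ≥0) : ℝ) : ℂ) ^ (-z)))) (μE₂.prod μF₂) := by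
  haveI : SecondCountableTopology (FiniteAdeleRing (𝓞 L) L) := secondCountableTopology_finiteAdeleRing L
  haveI : SecondCountableTopology (FiniteAdeleRing (𝓞 ↥(maximalRealSubfield L)) ↥(maximalRealSubfield L)) := secondCountableTopology_finiteAdeleRing _
  exact integrable_mul_ofReal_cpow_of_rpow (continuous_coe_heightFactor_fin L hc hcδ hδ).aestronglyMeasurable
    (fun q => one_le_coe_finprod_heisZ_line_cm_three L hcδ hδ _ _) (fun q => Ω q.1 q.2) hΩm (fun q => hΩM q.1 q.2) hsph

/-! ## §4 HEAD′: the same letter from the Godement letter `hT` through ★ K2E2-p12 §4; a continuous weight is measurable -/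

include hc in
/-- **HEAD′ — `hfin` FROM THE GODEMENT LETTER.**  Under `hc1`, the Iwasawa decomposition `hIw`, and `hT : v ↦ H(ι(w₀)·v)^{Re z} ∈ L¹(N(𝔸_{L⁺}))` (`2 < Re z`), ★ K2E2-p12 §4
`integrable_prod_heightFactor_rpow_of_integrable` supplies the spherical letter of §3, whence ★ p864589's `hfin` for every a.e.-strongly measurable bounded weight `Ω`.
[cite: MoeglinWaldspurger1995, II.1.6–II.1.7] [cite: CasselsFrohlichANT1967, Ch. XV §3.3] -/
theorem integrable_finiteWitness_of_height_integrable (hc1 : IsCMField.complexConj L ≠ 1)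
    (hIw : ∀ g : (quasiSplit (↥(maximalRealSubfield L)) L (IsCMField.complexConj L) 3).Adelic, ∃ b ∈ borelAdelic ↥(maximalRealSubfield L) L (IsCMField.complexConj L) 3, ∃ k : (quasiSplit (↥(maximalRealSubfield L)) L (IsCMField.complexConj L) 3).Adelic,
      adelicVal ↥(maximalRealSubfield L) L (IsCMField.complexConj L) 3 ((StdForm.antidiagonal 3).over L) k ∈ standardMaximalCompactGL 3 L ∧ g = b * k)
    [MeasurableSpace ↥(adelicUnipotent ↥(maximalRealSubfield L) L (IsCMField.complexConj L) 3)] [BorelSpace ↥(adelicUnipotent ↥(maximalRealSubfield L) L (IsCMField.complexConj L) 3)]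
    [MeasurableSpace (AdeleRing (𝓞 L) L)] [BorelSpace (AdeleRing (𝓞 L) L)]
    [MeasurableSpace (AdeleRing (𝓞 ↥(maximalRealSubfield L)) ↥(maximalRealSubfield L))] [BorelSpace (AdeleRing (𝓞 ↥(maximalRealSubfield L)) ↥(maximalRealSubfield L))]
    [MeasurableSpace (InfiniteAdeleRing L)] [BorelSpace (InfiniteAdeleRing L)]
    [MeasurableSpace (InfiniteAdeleRing ↥(maximalRealSubfield L))] [BorelSpace (InfiniteAdeleRing ↥(maximalRealSubfield L))]
    [MeasurableSpace (FiniteAdeleRing (𝓞 L) L)] [BorelSpace (FiniteAdeleRing (𝓞 L) L)]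
    [MeasurableSpace (FiniteAdeleRing (𝓞 ↥(maximalRealSubfield L)) ↥(maximalRealSubfield L))] [BorelSpace (FiniteAdeleRing (𝓞 ↥(maximalRealSubfield L)) ↥(maximalRealSubfield L))]
    (ν : Measure ↥(adelicUnipotent ↥(maximalRealSubfield L) L (IsCMField.complexConj L) 3)) [ν.IsHaarMeasure]
    (μE : Measure (AdeleRing (𝓞 L) L)) [μE.IsAddHaarMeasure] (μE₁ : Measure (InfiniteAdeleRing L)) [μE₁.IsAddHaarMeasure]
    (μE₂ : Measure (FiniteAdeleRing (𝓞 L) L)) [μE₂.IsAddHaarMeasure]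
    (μF : Measure (AdeleRing (𝓞 ↥(maximalRealSubfield L)) ↥(maximalRealSubfield L))) [μF.IsAddHaarMeasure] (μF₁ : Measure (InfiniteAdeleRing ↥(maximalRealSubfield L))) [μF₁.IsAddHaarMeasure]
    (μF₂ : Measure (FiniteAdeleRing (𝓞 ↥(maximalRealSubfield L)) ↥(maximalRealSubfield L))) [μF₂.IsAddHaarMeasure]
    {z : ℂ} (hz : 2 < z.re)
    (hT : Integrable (fun v : ↥(adelicUnipotent ↥(maximalRealSubfield L) L (IsCMField.complexConj L) 3) =>
      ((((borelHeight (((quasiSplit (↥(maximalRealSubfield L)) L (IsCMField.complexConj L) 3).toAdelic (weylLongU ((IsCMField.complexConj L : L ≃ₐ[↥(maximalRealSubfield L)] L) : L →+* L) (rfl : ((StdForm.antidiagonal 3).over L) = ((StdForm.antidiagonal 3).over L)))) * (v : (quasiSplit (↥(maximalRealSubfield L)) L (IsCMField.complexConj L) 3).Adelic))) : ℝ) ^ z.re : ℝ) : ℂ)) ν)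
    (Ω : FiniteAdeleRing (𝓞 L) L → FiniteAdeleRing (𝓞 ↥(maximalRealSubfield L)) ↥(maximalRealSubfield L) → ℂ)
    (hΩm : AEStronglyMeasurable (fun q : FiniteAdeleRing (𝓞 L) L × FiniteAdeleRing (𝓞 ↥(maximalRealSubfield L)) ↥(maximalRealSubfield L) => Ω q.1 q.2) (μE₂.prod μF₂))
    {M : ℝ} (hΩM : ∀ X b, ‖Ω X b‖ ≤ M) :
    Integrable (fun q : FiniteAdeleRing (𝓞 L) L × FiniteAdeleRing (𝓞 ↥(maximalRealSubfield L)) ↥(maximalRealSubfield L) =>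
        (Ω (q.1) (q.2) * ((((∏ᶠ w : HeightOneSpectrum (𝓞 L), max 1 (max ‖((((0 : InfiniteAdeleRing L)), q.1) : AdeleRing (𝓞 L) L).2 w‖₊ ‖(heisZ (c := IsCMField.complexConj L) ((((0 : InfiniteAdeleRing L)), q.1) : AdeleRing (𝓞 L) L) ((traceZeroLine ↥(maximalRealSubfield L) L (IsCMField.complexConj L) hcδ hδ ((0, q.2) : AdeleRing (𝓞 ↥(maximalRealSubfield L)) ↥(maximalRealSubfield L)) : traceZeroAdele ↥(maximalRealSubfield L) L (IsCMField.complexConj L)) : AdeleRing (𝓞 L) L)).2 w‖₊) : ℝ≥0) : ℝ) : ℂ) ^ (-z)))) (μE₂.prod μF₂) :=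
  integrable_finiteWitness_of_spherical L hc hcδ hδ μE₂ μF₂ Ω hΩm hΩM
    (integrable_prod_heightFactor_rpow_of_integrable L hc hcδ hδ hc1 hIw ν μE μE₁ μE₂ μF μF₁ μF₂ hz hT)

omit [IsCMField L] in
/-- **A CONTINUOUS FINITE WEIGHT IS A.E.-STRONGLY MEASURABLE ON `𝔸_{L,f} × 𝔸_{L⁺,f}`** (both factors second countable) — pays `hΩm` for a continuous `Ω`, e.g. the locally constant
witness weight `θ(b)·𝟙_{B_f·K_f(𝔫)}` on the clopen big-cell locus. [folklore] -/
theorem aestronglyMeasurable_weight_of_continuous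
    [MeasurableSpace (FiniteAdeleRing (𝓞 L) L)] [BorelSpace (FiniteAdeleRing (𝓞 L) L)]
    [MeasurableSpace (FiniteAdeleRing (𝓞 ↥(maximalRealSubfield L)) ↥(maximalRealSubfield L))] [BorelSpace (FiniteAdeleRing (𝓞 ↥(maximalRealSubfield L)) ↥(maximalRealSubfield L))]
    (μ : Measure (FiniteAdeleRing (𝓞 L) L × FiniteAdeleRing (𝓞 ↥(maximalRealSubfield L)) ↥(maximalRealSubfield L)))
    (Ω : FiniteAdeleRing (𝓞 L) L → FiniteAdeleRing (𝓞 ↥(maximalRealSubfield L)) ↥(maximalRealSubfield L) → ℂ)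
    (hΩc : Continuous fun q : FiniteAdeleRing (𝓞 L) L × FiniteAdeleRing (𝓞 ↥(maximalRealSubfield L)) ↥(maximalRealSubfield L) => Ω q.1 q.2) :
    AEStronglyMeasurable (fun q : FiniteAdeleRing (𝓞 L) L × FiniteAdeleRing (𝓞 ↥(maximalRealSubfield L)) ↥(maximalRealSubfield L) => Ω q.1 q.2) μ := by
  haveI : SecondCountableTopology (FiniteAdeleRing (𝓞 L) L) := secondCountableTopology_finiteAdeleRing L
  haveI : SecondCountableTopology (FiniteAdeleRing (𝓞 ↥(maximalRealSubfield L)) ↥(maximalRealSubfield L)) := secondCountableTopology_finiteAdeleRing _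
  exact hΩc.aestronglyMeasurable

end Summit.HodgeConjecture.HodgeConjecture.Cruxes.H413.K2E1ChiFiniteWitnessIntegrableU3

end
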